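/-
Copyright (c) 2026. All rights reserved.
Released under Apache 2.0 license as described in the file LICENSE.
Authors: abc-iut cell, seat abc-iut-w6-d023 (gen 0; node `AbsTopIII:Cor4.5(ii)` — item (ii) ALONE at the
archimedean models with zero binders, and its non-tautology over abstract archimedean-direction data).
-/
import Literature.AnabelianGeometry.AbsoluteAnabelian.AbsTopIII.AutHolLogFrobeniusModelProofs
import Literature.AnabelianGeometry.AbsoluteAnabelian.AbsTopIII.AutHolLogFrobeniusGaloisModel
import Literature.AnabelianGeometry.AbsoluteAnabelian.AbsTopIII.FrobeniusPictureMLFTelecoreIff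
import Literature.AnabelianGeometry.AbsoluteAnabelian.ArchimedeanLogFrobeniusModelTM
import Literature.AnabelianGeometry.AbsoluteAnabelian.ArchimedeanHolFieldFunctorGeometric
import Mathlib.CategoryTheory.SingleObj
import Mathlib.CategoryTheory.Groupoid
import Mathlib.Data.ZMod.Basic
import HarnessLib

/-!
# [AbsTopIII] Cor 4.5 (ii) — the telecore `𝔗_LH` and contact structure `ℋ_LH` — DISCHARGED at the
# archimedean models with NO residual hypothesis, and NOT a tautology over abstract archimedean data

S. Mochizuki, *Topics in Absolute Anabelian Geometry III*, Cor 4.5 (ii) p. 108 (kurims manuscript, lit key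
`paper:url-5493eb38cbb7`, read on the page; bib key `MochizukiAbsTopIII2015`): "the equivalence of
categories `κ_LH : EA ⥲ LinHol`, the forgetful functor `φ_LH : LinHol → 𝒳` [an equivalence, quasi-inverse
`π_LH`] … give rise to a telecore structure `𝔗_LH` on `𝒟_{≤4}` … Finally, … the collection of natural
transformations `{η_{□⋎}, η_{□⋎}⁻¹, η_⋏, η_⋏⁻¹}_{⋎ ∈ L, ⋏ ∈ L†}` generate a contact structure `ℋ_LH` on the
telecore `𝔗_LH`."  PROOF-ONLY companion (abc-iut cell, node `AbsTopIII:Cor4.5(ii)`, W6 tranche 1 row d023;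
no notion is declared) of abc-iut-L4-t10's statement file `AbsTopIII/AutHolLogFrobenius.lean`
(`AbsTopIII.Cor_4_5_ii Δ τ := Δ.TelecoreStmt τ`, imported, never restated).

State of the node in the tree before this file.  Over ABSTRACT input data the typed item (ii) is proved
from exactly its two printed-case shape hypotheses — `id_⋎` fully faithful and the first-row telecore
datum `τ = (φ_⋎, e, η_⋎)` COHERENT, "`η_⋏` the isomorphism arising from `η_An`" —
(`LogFrobeniusData.cor_4_5_ii_of_coherent`, abc-iut-L4-t5), coherence is NECESSARY
(`LogFrobeniusData.telecoreStmt_iff_coherent`, abc-iut-w5-d061) and the typed statement is falsifiable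
for MLF-direction data (`AbsTopIII.exists_not_telecoreStmt`, abc-iut-w5-d061); at the archimedean MODELS
item (ii) so far only appears BUNDLED with items (i), (iii)–(v) (`cor_4_5_arch_items`,
`cor_4_5_arch_TM_items`, `cor_4_5_arch_ofGaloisCategory_items`, `HolRS.cor_4_5_geometric`), hence behind
the binders `X₀ : EA`, `IsIdRigid EA` / `IsSlimGroup Π` that items (iv), (v) use and item (ii) does not.

This file:

* `AbsTopIII.cor_4_5_ii_iff_coherent` — the node's abstract closure BY NAME: for fully faithful `id_⋎`,
  `Cor_4_5_ii Δ τ ↔ (η_⋎ arises from η_An)` (abc-iut-w5-d061's iff, read at the node's decl).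
* `AbsTopIII.exists_isAutHolDirection_not_cor_4_5_ii` — DEGENERATE-WITNESS / non-tautology pass IN THE
  ARCHIMEDEAN DIRECTION (`ι_× : λ^∼ → λ^×`, Rmk 4.5.2): there are archimedean-direction abstract data with
  `id_⋎ = 𝟭` fully faithful and an incoherent telecore datum (the identification `e : id_⋎ ∘ φ_⋎ ≅ φ_□`
  twisted by the central element `g ≠ 1` of the one-object groupoid of `ℤ/2`) at which `Cor_4_5_ii` FAILS
  — so NO hypothesis-free `∀ Δ τ` form of the typed item (ii) exists, and "iff coherent" is the honest
  abstract closure (adapted from abc-iut-w5-d061's `FrobeniusPictureMLFTelecoreCountermodel.lean`, where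
  `ι_×` has the §3 direction).
* `AbsTopIII.cor_4_5_ii_arch`, `AbsTopIII.cor_4_5_ii_arch_TM` — **item (ii) at BOTH archimedean models
  (`𝒳 = 𝒞^hol_TF`, `𝒳 = 𝒞^hol_TM`) for EVERY interface datum `𝔄 : AutHolFieldFunctor`, ZERO binders**:
  the printed telecore datum `⟨φ_LH, unitor, η_LH⟩` is coherent by construction
  (`arch_telecore_coherent`, `archTM_telecore_coherent`, abc-iut-L4-t10 / -w5-d226) and `id_⋎ = 𝟭`.
* zero-binder corollaries at the tree's three model families of the interface: every constant-field
  datum (`cor_4_5_ii_ofConstField`), every Galois category `B(Π)` with NO slimness assumption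
  (`cor_4_5_ii_ofGaloisCategory`), and every GEOMETRIC carrier property `Q` on connected Riemann surfaces
  — including print's elliptically admissible hyperbolic `EA`, with NO id-rigidity / Lemma-4.3 input
  (`HolRS.cor_4_5_ii_geometric`).

HONEST SCOPE: model-level ≠ node-level ≠ reconstruction; the models' `𝒩` is `𝒞^hol_TH` restricted to
arithmetic data inside CAFs (scope note of `ArchimedeanLogFrobeniusModel.lean`).  Refereed pre-IUT
anabelian geometry; nothing here bears on [IUTchIII] Cor. 3.12 or takes a side; typed ≠ proved.
-/

namespace Literature.AnabelianGeometry.AbsoluteAnabelian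

open _root_.CategoryTheory

universe u

namespace AbsTopIII

/-! ### The abstract node: closure "iff coherent", and non-tautology in the archimedean direction -/

/-- **[AbsTopIII] Cor 4.5 (ii) as typed ⟺ coherence of `η_⋎` with `η_LH`** (abc-iut-w5-d061's
`telecoreStmt_iff_coherent` read at abc-iut-L4-t10's node decl `Cor_4_5_ii`): for abstract input data
`Δ` with `id_⋎` fully faithful and first-row telecore data `τ = (φ_⋎, e, η_⋎)`, `Cor_4_5_ii Δ τ` holds if
and only if `id_⋎ (η_⋎)_x = e_{π(id_⋎ x)} ∘ (η_LH)_{id_⋎ x}` for every `x` ("`η_⋏` … the isomorphism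
arising from `η_LH`"; printed case `φ_⋎ = φ_LH`, `e = 𝟙`, `η_⋎ = η_LH`: trivially).
[cite: MochizukiAbsTopIII2015, Corollary 4.5 (ii) p.108] -/
theorem cor_4_5_ii_iff_coherent (Δ : LogFrobeniusData.{u}) (τ : Δ.TelecoreData)
    (hν : Δ.toNexus.FullyFaithful) :
    Cor_4_5_ii Δ τ ↔ ∀ x : Δ.X₁, Δ.toNexus.map (τ.η₁.hom.app x) =
      τ.e.hom.app (Δ.κ.obj (Δ.XtoE.obj (Δ.toNexus.obj x))) ≫ Δ.η.hom.app (Δ.toNexus.obj x) :=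
  Δ.telecoreStmt_iff_coherent τ hν

/-- **The typed [AbsTopIII] Cor 4.5 (ii) is NOT a tautology over abstract ARCHIMEDEAN-direction data**
(degenerate-witness pass): there are `Δ : LogFrobeniusData` of Aut-holomorphic type (`ι_× : λ^∼ → λ^×` in
the right summand, Rmk 4.5.2) with `id_⋎ = 𝟭` fully faithful, and first-row telecore data `τ`, such that
`¬ Cor_4_5_ii Δ τ`: all six categories the one-object groupoid of `ℤ/2`, all functors identities, `η_LH`
and `η_⋎` unitors, and `e : id_⋎ ∘ φ_⋎ ≅ φ_□` twisted by the central element `g ≠ 1`; the coherence forced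
by `coherent_of_telecoreStmt` then reads `1 = g`.  Adapted from abc-iut-w5-d061's MLF-direction witness
`exists_not_telecoreStmt`.  A toy, not the geometric data.
[cite: MochizukiAbsTopIII2015, Corollary 4.5 (ii) p.108] -/
theorem exists_isAutHolDirection_not_cor_4_5_ii :
    ∃ (Δ : LogFrobeniusData.{0}) (τ : Δ.TelecoreData),
      IsAutHolDirection Δ ∧ Nonempty Δ.toNexus.FullyFaithful ∧ ¬ Cor_4_5_ii Δ τ := by
  let G2 : Type := Multiplicative (ZMod 2)
  let Δ : LogFrobeniusData.{0} :=
    { X₁ := SingleObj G2, X := SingleObj G2, toNexus := 𝟭 _, N := SingleObj G2, E := SingleObj G2,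
      A := SingleObj G2, log := 𝟭 _, logIsoId := Iso.refl _, lamTimes := 𝟭 _, lamPf := 𝟭 _,
      ιlog := (Functor.rightUnitor (𝟭 (SingleObj G2) ⋙ 𝟭 (SingleObj G2))).hom, ιtimes := Sum.inr (𝟙 _),
      XtoE := 𝟭 _, NtoE := 𝟭 _, lamTimes_NtoE := Functor.comp_id _, lamPf_NtoE := Functor.comp_id _,
      κ := 𝟭 _, AtoE := 𝟭 _, κ_equiv := inferInstance, κ_inv := Functor.rightUnitor _,
      φ := 𝟭 _, φ_equiv := inferInstance, η := Functor.rightUnitor _ ≪≫ Functor.rightUnitor _ }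
  -- the non-trivial central automorphism `g` of the unique object
  let g : (SingleObj.star G2) ≅ (SingleObj.star G2) :=
    (Groupoid.isoEquivHom (SingleObj.star G2) (SingleObj.star G2)).symm (Multiplicative.ofAdd (1 : ZMod 2))
  have hg : g.hom = Multiplicative.ofAdd (1 : ZMod 2) := rfl
  -- the twisted telecore datum
  let τ : Δ.TelecoreData :=
    { φ₁ := 𝟭 _
      e := NatIso.ofComponents (fun _ => g) (fun {X Y} f => by
        simp only [Functor.comp_map, Functor.id_map, hg]
        exact mul_comm (Multiplicative.ofAdd (1 : ZMod 2) : G2) (f : G2))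
      η₁ := Functor.rightUnitor _ ≪≫ Functor.rightUnitor _ ≪≫ Functor.rightUnitor _ }
  refine ⟨Δ, τ, ⟨𝟙 _, rfl⟩, ⟨Functor.FullyFaithful.id _⟩, fun h => ?_⟩
  have key := Δ.coherent_of_telecoreStmt τ h (SingleObj.star G2)
  simp only [Δ, τ, Functor.id_obj, Functor.id_map, Iso.trans_hom, NatTrans.comp_app,
    Functor.rightUnitor_hom_app, NatIso.ofComponents_hom_app, hg] at key
  -- `key : 𝟙 ⋆ = g`
  have k3 : (Multiplicative.ofAdd (1 : ZMod 2) : G2) = 1 := by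
    rw [← SingleObj.id_as_one G2 (SingleObj.star G2)]; exact key.symm
  exact absurd (Multiplicative.ofAdd.injective (k3.trans ofAdd_zero.symm)) (by decide)

/-- Hence no hypothesis-free form of the typed item (ii) over abstract archimedean-direction data: it is
NOT the case that `Cor_4_5_ii Δ τ` holds for every Aut-holomorphic-type `Δ` with fully faithful `id_⋎`
and every `τ` — the printed sentence "`η_⋏` the isomorphism arising from `η_LH`" is used essentially.
[cite: MochizukiAbsTopIII2015, Corollary 4.5 (ii) p.108] -/
theorem not_forall_isAutHolDirection_cor_4_5_ii :
    ¬ ∀ (Δ : LogFrobeniusData.{0}) (τ : Δ.TelecoreData),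
      IsAutHolDirection Δ → Nonempty Δ.toNexus.FullyFaithful → Cor_4_5_ii Δ τ := by
  intro h
  obtain ⟨Δ, τ, hdir, hν, hnot⟩ := exists_isAutHolDirection_not_cor_4_5_ii
  exact hnot (h Δ τ hdir hν)

/-! ### Item (ii) alone at the archimedean models: zero binders -/

/-- **[AbsTopIII] Cor 4.5 (ii) at the archimedean MODEL `𝒳 = 𝒞^hol_TF`, for EVERY interface datum
`𝔄 : AutHolFieldFunctor`, with NO further hypothesis**: the telecore `𝔗_LH` over the core `(𝒟_{≤5}, LinHol)`
with telecore edges `φ_⋏ = φ_LH`, `⋏ ∈ L†`, and its contact structure `ℋ_LH` generated by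
`{η_{□⋎}^{±1}, η_⋏^{±1}}` with the printed homotopies, for the data `archLogFrobeniusData 𝔄` and the printed
first-row telecore datum `archTelecoreData 𝔄 = ⟨φ_LH, unitor, η_LH⟩` — abc-iut-L4-t5's
`cor_4_5_ii_of_coherent` with both shape hypotheses discharged by construction (`id_⋎ = 𝟭`;
`arch_telecore_coherent`).  Items (iv), (v) need `X₀ : EA` and the id-rigidity of `EA`; item (ii) does not.
[cite: MochizukiAbsTopIII2015, Corollary 4.5 (ii) p.108] -/
theorem cor_4_5_ii_arch (𝔄 : AutHolFieldFunctor.{u}) :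
    Cor_4_5_ii (archLogFrobeniusData 𝔄) (archTelecoreData 𝔄) :=
  (archLogFrobeniusData 𝔄).cor_4_5_ii_of_coherent (archTelecoreData 𝔄)
    (Functor.FullyFaithful.id (HolTFPair 𝔄)) (arch_telecore_coherent 𝔄)

/-- **[AbsTopIII] Cor 4.5 (ii) at the archimedean MODEL `𝒳 = 𝒞^hol_TM`** ("where `T ∈ {TM, TF}`"), for
EVERY interface datum `𝔄`, with NO further hypothesis (coherence: abc-iut-w5-d226's
`archTM_telecore_coherent`). [cite: MochizukiAbsTopIII2015, Corollary 4.5 (ii) p.108] -/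
theorem cor_4_5_ii_arch_TM (𝔄 : AutHolFieldFunctor.{u}) :
    Cor_4_5_ii (archLogFrobeniusDataTM 𝔄) (archTelecoreDataTM 𝔄) :=
  (archLogFrobeniusDataTM 𝔄).cor_4_5_ii_of_coherent (archTelecoreDataTM 𝔄)
    (Functor.FullyFaithful.id (HolMonoidPair 𝔄 .TM)) (archTM_telecore_coherent 𝔄)

/-- Cor 4.5 (ii) at the archimedean model over EVERY constant-field datum `EA := E` (any category `E`,
`𝒜_𝕏 = ℂ`), zero binders. [cite: MochizukiAbsTopIII2015, Corollary 4.5 (ii) p.108] -/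
theorem cor_4_5_ii_ofConstField (E : Type 1) [Category.{1} E] :
    Cor_4_5_ii (archLogFrobeniusData (AutHolFieldFunctor.ofConstField E))
      (archTelecoreData (AutHolFieldFunctor.ofConstField E)) :=
  cor_4_5_ii_arch _

/-- **Cor 4.5 (ii) at the Galois-category instance `EA = B(Π)` for EVERY topological group `Π`, with NO
slimness hypothesis** (contrast `cor_4_5_arch_ofGaloisCategory_items (hG : IsSlimGroup Π) (X₀)`, whose
binders serve items (iv), (v)). [cite: MochizukiAbsTopIII2015, Corollary 4.5 (ii) p.108] -/
theorem cor_4_5_ii_ofGaloisCategory (G : Type) [Group G] [TopologicalSpace G] :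
    Cor_4_5_ii (archLogFrobeniusData (AutHolFieldFunctor.ofGaloisCategory G))
      (archTelecoreData (AutHolFieldFunctor.ofGaloisCategory G)) :=
  cor_4_5_ii_arch _

end AbsTopIII

namespace HolRS

/-- **[AbsTopIII] Cor 4.5 (ii) at the GEOMETRIC model for EVERY object property `Q` of connected Riemann
surfaces** — `EA = EA^hol_RS(Q)` (abc-iut-L4-t14's `geometricAutHolFieldFunctor Q`), in particular for
print's elliptically admissible hyperbolic orbicurves — with NO id-rigidity / Lemma-4.3 input (contrast
`cor_4_5_geometric (X₀) (hE : IsIdRigid EA)`, needed for items (iv), (v) only).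
[cite: MochizukiAbsTopIII2015, Corollary 4.5 (ii) p.108] -/
theorem cor_4_5_ii_geometric (Q : ObjectProperty HolRS) :
    AbsTopIII.Cor_4_5_ii (archLogFrobeniusData (geometricAutHolFieldFunctor Q))
      (archTelecoreData (geometricAutHolFieldFunctor Q)) :=
  AbsTopIII.cor_4_5_ii_arch _

end HolRS

end Literature.AnabelianGeometry.AbsoluteAnabelian
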